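import Summits.CriticalPhenomena.PercolationContinuityZ3.Theorems.PercNearOneGluingNoHeavyLowerTailAPLThreePointAll
import HarnessLib

/-!
# `NoHeavyLowerTail` (stmt-CriticalPhenomena-4575) — a cluster-moment corollary of the three-point inequality:
# `(E Σ_C |C|³)² ≤ 3·(E Σ_C |C|²)³` on every finite weighted graph

Support file (prover prim-ineq-gen-8 gen 56; `--supports stmt-CriticalPhenomena-4575`; memo
run/shared/lean/prim/prim-ineq-gen-8/FINDING-gen56-CASCADE.md §3).  No definitions, no named facts, no sorries.

`μ = prodBernoulli w` on the pairs of a finite vertex type `V`; `C(x)` the open cluster of `x`.  Since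
`Σ_y μ(x↔y) = E|C(x)|` and `Σ_{y,z} μ(x↔y ∩ x↔z) = E|C(x)|²`, the sums
`S₂ := Σ_x Σ_y μ(x↔y) = E Σ_C |C|²` and `S₃ := Σ_x Σ_y Σ_z μ(x↔y ∩ x↔z) = E Σ_C |C|³` are the second and third
cluster-size moment sums (diagonal terms included).  Summing the Gladkov-type bound with constant `3`
(`APL.gladkov3_all`: `μ(x↔y ∩ x↔z)² ≤ 3·μ(x↔y)μ(x↔z)μ(y↔z)`) over all triples and applying Cauchy–Schwarz twice to the
symmetric kernel `M_xy = √μ(x↔y)` (`Σ_{xyz} M_xy M_xz M_yz ≤ (Σ_xy M_xy²)^{3/2}`) gives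
* **`clusterMoments_three_two`** — `S₃² ≤ 3·S₂³`, i.e. `(E Σ_C|C|³)² ≤ 3 (E Σ_C|C|²)³`; for a vertex-transitive graph on `n`
  vertices this is the finite-size inequality `(E|C|²)² ≤ 3n·(E|C|)³` at every edge density (informative in and above the
  critical window, where the Aizenman–Newman tree-graph bound `E|C|² ≤ (E|C|)³` is weak).
The real-variable core is `APL.sum3_sq_le_three_mul_cube` (any symmetric nonnegative kernel `a` and nonnegative `t` with
`t_xyz² ≤ 3 a_xy a_xz a_yz`).  The ratio `S₃²/S₂³` is the quantity whose supremum over the critical window of `K_n` (with hub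
terminals) calibrates the Delfino–Viti-type constant of the lineage from below (memo §1).  [this work]
-/

noncomputable section

namespace Summit.CriticalPhenomena.PercolationContinuityZ3.Theorems

namespace APL

open MeasureTheory Set Literature.Probability.Percolation Literature.Probability.LatticeModels
open scoped Classical

variable {V : Type*} [Fintype V]

/-- **Real-variable core.**  If `a : V → V → ℝ` is symmetric and nonnegative, `t : V → V → V → ℝ` is nonnegative and
`t x y z ^ 2 ≤ 3 · a x y · a x z · a y z` for all `x y z`, then `(Σ_{xyz} t)² ≤ 3 (Σ_{xy} a)³`
(two Cauchy–Schwarz steps on `M = √a`: `Σ_{xyz} M_xy M_xz M_yz ≤ (Σ M²)^{3/2}`). [this work] -/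
theorem sum3_sq_le_three_mul_cube (a : V → V → ℝ) (t : V → V → V → ℝ)
    (ha : ∀ x y, 0 ≤ a x y) (hsymm : ∀ x y, a x y = a y x) (ht : ∀ x y z, 0 ≤ t x y z)
    (h3 : ∀ x y z, t x y z ^ 2 ≤ 3 * a x y * a x z * a y z) :
    (∑ x, ∑ y, ∑ z, t x y z) ^ 2 ≤ 3 * (∑ x, ∑ y, a x y) ^ 3 := by
  -- the square-root kernel
  set M : V → V → ℝ := fun x y => Real.sqrt (a x y) with hM
  have hM0 : ∀ x y, 0 ≤ M x y := fun x y => Real.sqrt_nonneg _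
  have hM2 : ∀ x y, M x y ^ 2 = a x y := fun x y => Real.sq_sqrt (ha x y)
  have hMs : ∀ x y, M x y = M y x := fun x y => by simp only [hM, hsymm x y]
  -- pointwise: t ≤ √3 · M M M
  have hpt : ∀ x y z, t x y z ≤ Real.sqrt 3 * (M x y * M x z * M y z) := by
    intro x y z
    have hR : 0 ≤ Real.sqrt 3 * (M x y * M x z * M y z) :=
      mul_nonneg (Real.sqrt_nonneg _) (mul_nonneg (mul_nonneg (hM0 _ _) (hM0 _ _)) (hM0 _ _))
    have hsq : t x y z ^ 2 ≤ (Real.sqrt 3 * (M x y * M x z * M y z)) ^ 2 := by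
      have e : (Real.sqrt 3 * (M x y * M x z * M y z)) ^ 2 = 3 * a x y * a x z * a y z := by
        rw [mul_pow, Real.sq_sqrt (by norm_num : (0:ℝ) ≤ 3), mul_pow, mul_pow, hM2, hM2, hM2]; ring
      rw [e]; exact h3 x y z
    exact (pow_le_pow_iff_left₀ (ht x y z) hR (by norm_num : (2:ℕ) ≠ 0)).1 hsq
  -- S and T
  set S : ℝ := ∑ x, ∑ y, a x y with hS
  set T : ℝ := ∑ x, ∑ y, ∑ z, M x y * M x z * M y z with hT
  have hS' : S = ∑ x, ∑ y, M x y ^ 2 := by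
    rw [hS]; exact Finset.sum_congr rfl fun x _ => Finset.sum_congr rfl fun y _ => (hM2 x y).symm
  have hS0 : 0 ≤ S := Finset.sum_nonneg fun x _ => Finset.sum_nonneg fun y _ => ha x y
  -- (1) Σ t ≤ √3 · T
  have h1 : ∑ x, ∑ y, ∑ z, t x y z ≤ Real.sqrt 3 * T := by
    rw [hT, Finset.mul_sum]
    refine Finset.sum_le_sum fun x _ => ?_
    rw [Finset.mul_sum]
    refine Finset.sum_le_sum fun y _ => ?_
    rw [Finset.mul_sum]
    exact Finset.sum_le_sum fun z _ => hpt x y z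
  -- (2) T² ≤ S³ : rewrite T = Σ_x Σ_z M_xz · N_xz with N_xz = Σ_y M_xy M_yz
  set N : V → V → ℝ := fun x z => ∑ y, M x y * M y z with hN
  have hTN : T = ∑ x, ∑ z, M x z * N x z := by
    rw [hT]
    refine Finset.sum_congr rfl fun x _ => ?_
    rw [Finset.sum_comm]
    refine Finset.sum_congr rfl fun z _ => ?_
    rw [hN, Finset.mul_sum]
    refine Finset.sum_congr rfl fun y _ => ?_
    rw [hMs y z]; ring
  -- Cauchy–Schwarz over the pairs (x,z)
  have hCS1 : (∑ x, ∑ z, M x z * N x z) ^ 2 ≤ (∑ x, ∑ z, M x z ^ 2) * (∑ x, ∑ z, N x z ^ 2) := by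
    have h := Finset.sum_mul_sq_le_sq_mul_sq (Finset.univ : Finset (V × V)) (fun q => M q.1 q.2) (fun q => N q.1 q.2)
    simpa only [Fintype.sum_prod_type] using h
  -- Cauchy–Schwarz inside N
  have hN2 : ∀ x z, N x z ^ 2 ≤ (∑ y, M x y ^ 2) * (∑ y, M z y ^ 2) := by
    intro x z
    have h := Finset.sum_mul_sq_le_sq_mul_sq (Finset.univ : Finset V) (fun y => M x y) (fun y => M y z)
    have e : (∑ y, M y z ^ 2) = ∑ y, M z y ^ 2 := Finset.sum_congr rfl fun y _ => by rw [hMs y z]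
    rw [hN]; rw [e] at h; exact h
  have hR : ∑ x, ∑ z, N x z ^ 2 ≤ S ^ 2 := by
    calc ∑ x, ∑ z, N x z ^ 2 ≤ ∑ x, ∑ z, (∑ y, M x y ^ 2) * (∑ y, M z y ^ 2) :=
          Finset.sum_le_sum fun x _ => Finset.sum_le_sum fun z _ => hN2 x z
      _ = (∑ x, ∑ y, M x y ^ 2) * (∑ z, ∑ y, M z y ^ 2) := by
          rw [Finset.sum_mul_sum]
      _ = S ^ 2 := by rw [← hS']; ring
  have h2 : T ^ 2 ≤ S ^ 3 := by
    rw [hTN]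
    calc (∑ x, ∑ z, M x z * N x z) ^ 2 ≤ (∑ x, ∑ z, M x z ^ 2) * (∑ x, ∑ z, N x z ^ 2) := hCS1
      _ ≤ S * S ^ 2 := by
          rw [← hS']
          exact mul_le_mul_of_nonneg_left hR hS0
      _ = S ^ 3 := by ring
  -- assemble
  have hsum0 : 0 ≤ ∑ x, ∑ y, ∑ z, t x y z :=
    Finset.sum_nonneg fun x _ => Finset.sum_nonneg fun y _ => Finset.sum_nonneg fun z _ => ht x y z
  calc (∑ x, ∑ y, ∑ z, t x y z) ^ 2 ≤ (Real.sqrt 3 * T) ^ 2 :=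
        pow_le_pow_left₀ hsum0 h1 2
    _ = 3 * T ^ 2 := by rw [mul_pow, Real.sq_sqrt (by norm_num : (0:ℝ) ≤ 3)]
    _ ≤ 3 * S ^ 3 := by linarith [h2]

/-- **Cluster-moment corollary of (★★₃) on every finite weighted graph**: with `μ = prodBernoulli w`,
`(Σ_x Σ_y Σ_z μ(x↔y ∩ x↔z))² ≤ 3·(Σ_x Σ_y μ(x↔y))³`, i.e. `(E Σ_C |C|³)² ≤ 3·(E Σ_C |C|²)³`
(`Σ_y μ(x↔y) = E|C(x)|`, `Σ_{y,z} μ(x↔y ∩ x↔z) = E|C(x)|²`).  From `gladkov3_all` summed over all triples and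
`sum3_sq_le_three_mul_cube`. [this work] -/
theorem clusterMoments_three_two (w : Sym2 V → unitInterval) :
    (∑ x, ∑ y, ∑ z, (prodBernoulli w).real ((openConn x y : Set (BondConfig V)) ∩ (openConn x z : Set (BondConfig V)))) ^ 2
      ≤ 3 * (∑ x, ∑ y, (prodBernoulli w).real (openConn x y : Set (BondConfig V))) ^ 3 := by
  refine sum3_sq_le_three_mul_cube (fun x y => (prodBernoulli w).real (openConn x y : Set (BondConfig V)))
    (fun x y z => (prodBernoulli w).real ((openConn x y : Set (BondConfig V)) ∩ (openConn x z : Set (BondConfig V))))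
    (fun x y => measureReal_nonneg) (fun x y => ?_) (fun x y z => measureReal_nonneg) (fun x y z => ?_)
  · -- symmetry of the two-point function
    have e : (openConn x y : Set (BondConfig V)) = openConn y x := by
      ext ω; exact ⟨fun h => SimpleGraph.Reachable.symm h, fun h => SimpleGraph.Reachable.symm h⟩
    simp only [e]
  · have h := gladkov3_all w x y z
    simpa only [mul_assoc] using h

end APL

end Summit.CriticalPhenomena.PercolationContinuityZ3.Theorems

end
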